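import Summits.NavierStokesRegularity.NavierStokesRegularity.Theses.OddMorawetz
import Summits.NavierStokesRegularity.NavierStokesRegularity.Theorems.OddMorawetzOddNoGoNS
import Summits.NavierStokesRegularity.NavierStokesRegularity.Theorems.OddMorawetzOddMorawetzLocalStubFluxTransfer
import Literature.Analysis.FluidPDE.TaoAveragedEulerContDiff
import HarnessLib

/-!
# Route OddMorawetz — `MorawetzKillsTypeI`: auxiliaries for the weight-one (hyperoctahedral) argument

(crux item `stmt-NavierStokesRegularity-1377`, line `birth`; lands `--supports` the crux; consumed by the proof of
the registered stub `stub_weightOne_glue`.)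

* `exists_signedPerm_isometry`, `signedPerm_symm_apply`, `signedPerm_symm_single` — the 48 signed permutation
  isometries `(R x)ᵢ = σᵢ x_{π⁻¹ i}` of `ℝ³` (hyperoctahedral group `B₃`), their inverses and their action on the
  standard basis.
* `norm_fderiv_le_of_cubic` — a `C¹` cubic form on a finite-dimensional space has `‖Dm(z)‖ ≤ M ‖z‖²` (the
  derivative is `2`-homogeneous, tree `oddNoGoNS_fderiv_cubic`, and bounded on the unit ball).
* `integrable_morawetzPairing` — for a smooth cubic density `m` on 3-jets and a Schwartz field `v`, the Morawetz
  pairing `x ↦ Dm(Jv x)[J B(v,v) x]` is integrable on `ℝ³`: Schwartz decay of `Jv` (tree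
  `StubFluxTransfer.jet_bounds`), the quadratic bound, and `B(v,v)` with three derivatives in `L²` (tree
  `contDiff_eulerBilinear_holds`), via `ab ≤ (a² + b²)/2`.
* `cmm_one_smul`, `sum4_reindex`, `density_signedPerm` — the coordinate form `Σ τ_ijpq z₀ᵢ z₀ⱼ (z₁ e_p)_q` of a
  weight-one density transformed by the jet action `ρ_R` of a signed permutation `R`, reindexed so that the sum
  over `B₃` is literally the left-hand side of the finite averaging identity (`stub_weightOne_average`).
-/

noncomputable section

-- the route's Theorems namespace repeats the summit name by design (Summit.<S>.<P>.Theorems, S = P)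
set_option linter.dupNamespace false

namespace Summit.NavierStokesRegularity.NavierStokesRegularity.Theorems

open MeasureTheory

/-! ### Signed permutations and the quadratic bound -/

/-- **The signed permutation isometries of `ℝ³`** (hyperoctahedral group `B₃`, 48 elements): for a sign
vector `s` and a permutation `π` there is a linear isometry `R` with `(R x)ᵢ = σᵢ x_{π⁻¹ i}`, `σᵢ = ±1`
(coordinate permutation `LinearIsometryEquiv.piLpCongrLeft` followed by coordinate reflections). -/
theorem exists_signedPerm_isometry (s : Fin 3 → Bool) (π : Equiv.Perm (Fin 3)) :
    ∃ R : EuclideanSpace ℝ (Fin 3) ≃ₗᵢ[ℝ] EuclideanSpace ℝ (Fin 3),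
      ∀ (x : EuclideanSpace ℝ (Fin 3)) (i : Fin 3), R x i = (if s i then (1 : ℝ) else -1) * x (π.symm i) := by
  refine ⟨(LinearIsometryEquiv.piLpCongrLeft 2 ℝ ℝ π).trans
    (LinearIsometryEquiv.piLpCongrRight 2 fun i =>
      if s i then LinearIsometryEquiv.refl ℝ ℝ else LinearIsometryEquiv.neg ℝ), fun x i => ?_⟩
  simp only [LinearIsometryEquiv.trans_apply, LinearIsometryEquiv.piLpCongrRight_apply,
    LinearIsometryEquiv.piLpCongrLeft_apply, Equiv.piCongrLeft'_apply]
  split_ifs with h <;> simp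

/-- The inverse of a signed permutation isometry in coordinates: `(R⁻¹ y)ⱼ = σ_{π j} y_{π j}`. -/
theorem signedPerm_symm_apply {s : Fin 3 → Bool} {π : Equiv.Perm (Fin 3)}
    {R : EuclideanSpace ℝ (Fin 3) ≃ₗᵢ[ℝ] EuclideanSpace ℝ (Fin 3)}
    (hR : ∀ (x : EuclideanSpace ℝ (Fin 3)) (i : Fin 3), R x i = (if s i then (1 : ℝ) else -1) * x (π.symm i))
    (y : EuclideanSpace ℝ (Fin 3)) (j : Fin 3) :
    R.symm y j = (if s (π j) then (1 : ℝ) else -1) * y (π j) := by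
  set w : EuclideanSpace ℝ (Fin 3) := WithLp.toLp 2 (fun j => (if s (π j) then (1 : ℝ) else -1) * y (π j)) with hw
  have hRw : R w = y := by
    ext i
    rw [hR w i]
    simp only [hw, PiLp.toLp_apply, Equiv.apply_symm_apply]
    cases s i <;> simp
  have : R.symm y = w := by rw [← hRw, LinearIsometryEquiv.symm_apply_apply]
  rw [this, hw, PiLp.toLp_apply]

/-- The inverse of a signed permutation isometry on the standard basis: `R⁻¹ e_p = σ_p e_{π⁻¹ p}`. -/
theorem signedPerm_symm_single {s : Fin 3 → Bool} {π : Equiv.Perm (Fin 3)}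
    {R : EuclideanSpace ℝ (Fin 3) ≃ₗᵢ[ℝ] EuclideanSpace ℝ (Fin 3)}
    (hR : ∀ (x : EuclideanSpace ℝ (Fin 3)) (i : Fin 3), R x i = (if s i then (1 : ℝ) else -1) * x (π.symm i))
    (p : Fin 3) :
    R.symm (EuclideanSpace.single p (1 : ℝ)) =
      (if s p then (1 : ℝ) else -1) • EuclideanSpace.single (π.symm p) (1 : ℝ) := by
  ext j
  rw [signedPerm_symm_apply hR, PiLp.smul_apply, smul_eq_mul]
  simp only [EuclideanSpace.single, PiLp.single_apply]
  by_cases h : π j = p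
  · have h' : j = π.symm p := by rw [← h, Equiv.symm_apply_apply]
    simp [h']
  · have h' : j ≠ π.symm p := fun h' => h (by rw [h', Equiv.apply_symm_apply])
    simp [h, h']

/-- **Quadratic bound on the derivative of a cubic form.** A `C¹` function `m` on a finite-dimensional real
normed space with `m(μ z) = μ³ m(z)` for all real `μ` satisfies `‖Dm(z)‖ ≤ M ‖z‖²` for some `M ≥ 0`: `Dm` is
`2`-homogeneous (`oddNoGoNS_fderiv_cubic`), vanishes at `0`, and is bounded on the closed unit ball. -/
theorem norm_fderiv_le_of_cubic {V : Type*} [NormedAddCommGroup V] [NormedSpace ℝ V] [FiniteDimensional ℝ V]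
    {m : V → ℝ} (hm : ContDiff ℝ 1 m) (hhom : ∀ (μ : ℝ) (z : V), m (μ • z) = μ ^ 3 * m z) :
    ∃ M : ℝ, 0 ≤ M ∧ ∀ z, ‖fderiv ℝ m z‖ ≤ M * ‖z‖ ^ 2 := by
  have hd : Differentiable ℝ m := hm.differentiable one_ne_zero
  obtain ⟨M, hM⟩ := (isCompact_closedBall (0 : V) 1).exists_bound_of_continuousOn
    (hm.continuous_fderiv one_ne_zero).continuousOn
  have hM0 : 0 ≤ M := (norm_nonneg _).trans (hM 0 (Metric.mem_closedBall_self zero_le_one))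
  refine ⟨M, hM0, fun z => ?_⟩
  by_cases hz : z = 0
  · -- `fderiv m 0 = 0` by homogeneity with `μ = 2`
    subst hz
    have h2 := Summit.NavierStokesRegularity.NavierStokesRegularity.Theorems.oddNoGoNS_fderiv_cubic hd hhom
      (μ := 2) two_ne_zero (0 : V)
    rw [smul_zero] at h2
    have h0 : fderiv ℝ m 0 = 0 := by
      have h3 := congrArg (fun L : V →L[ℝ] ℝ => ‖L‖) h2
      simp only [norm_smul] at h3
      have h4 : ‖fderiv ℝ m (0 : V)‖ = 0 := by norm_num at h3; linarith [norm_nonneg (fderiv ℝ m (0 : V))]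
      exact norm_eq_zero.1 h4
    simp [h0]
  · have hnz : ‖z‖ ≠ 0 := norm_ne_zero_iff.2 hz
    have hu : ‖‖z‖⁻¹ • z‖ = 1 := by rw [norm_smul, norm_inv, norm_norm, inv_mul_cancel₀ hnz]
    have key := Summit.NavierStokesRegularity.NavierStokesRegularity.Theorems.oddNoGoNS_fderiv_cubic hd hhom
      (μ := ‖z‖) hnz (‖z‖⁻¹ • z)
    rw [smul_smul, mul_inv_cancel₀ hnz, one_smul] at key
    rw [key, norm_smul, Real.norm_eq_abs, abs_of_nonneg (sq_nonneg _), mul_comm]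
    refine mul_le_mul_of_nonneg_right (hM _ ?_) (sq_nonneg _)
    rw [Metric.mem_closedBall, dist_zero_right, hu]


/-! ### Integrability of the Morawetz pairing -/

/-- **Integrability of the Morawetz pairing.** For a smooth pointwise-cubic density `m` on 3-jets and a Schwartz
field `v` on `ℝ³`, `x ↦ Dm(Jv x)[J B(v,v) x]` is integrable (`Jv = (v, Dv, D²v, D³v)`, `B = eulerBilinear`):
`|Dm(Jv)[Jb]| ≤ M ‖Jv‖² ‖Jb‖ ≤ (K²(1+|x|)⁻⁴ + ‖Jb‖²)/2` with `‖Jv x‖ ≤ S(1+|x|)⁻⁴` (Schwartz) and the four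
components of `Jb` square integrable (`contDiff_eulerBilinear_holds`). -/
theorem integrable_morawetzPairing :
    ∀ {m : EuclideanSpace ℝ (Fin 3) × (EuclideanSpace ℝ (Fin 3) [×1]→L[ℝ] EuclideanSpace ℝ (Fin 3)) × (EuclideanSpace ℝ (Fin 3) [×2]→L[ℝ] EuclideanSpace ℝ (Fin 3)) × (EuclideanSpace ℝ (Fin 3) [×3]→L[ℝ] EuclideanSpace ℝ (Fin 3)) → ℝ}
    (hsm : ContDiff ℝ (⊤ : ℕ∞) m) (hhom : ∀ (μ : ℝ) z, m (μ • z) = μ ^ 3 * m z)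
    {v : EuclideanSpace ℝ (Fin 3) → EuclideanSpace ℝ (Fin 3)} (hv : Literature.Analysis.FluidPDE.IsSchwartzField v),
    Integrable (fun x => fderiv ℝ m (v x, iteratedFDeriv ℝ 1 v x, iteratedFDeriv ℝ 2 v x, iteratedFDeriv ℝ 3 v x)
      (Literature.Analysis.FluidPDE.eulerBilinear v v x,
        iteratedFDeriv ℝ 1 (Literature.Analysis.FluidPDE.eulerBilinear v v) x,
        iteratedFDeriv ℝ 2 (Literature.Analysis.FluidPDE.eulerBilinear v v) x,
        iteratedFDeriv ℝ 3 (Literature.Analysis.FluidPDE.eulerBilinear v v) x)) := by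
  intro m hsm hhom v hv
  -- regularity of `b = B(v,v)`
  obtain ⟨hbs, hbL2⟩ := Literature.Analysis.FluidPDE.contDiff_eulerBilinear_holds (ι := Fin 3) hv hv
  set b := Literature.Analysis.FluidPDE.eulerBilinear v v with hb
  obtain ⟨f, rfl⟩ := hv
  -- Schwartz decay of the jets of `v`
  obtain ⟨S, hS⟩ : ∃ S : ℝ, ∀ n : ℕ, n ≤ 4 → ∀ x : EuclideanSpace ℝ (Fin 3),
      (1 + ‖x‖) ^ 4 * ‖iteratedFDeriv ℝ n (⇑f) x‖ ≤ S :=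
    ⟨_, fun n hn x => SchwartzMap.one_add_le_sup_seminorm_apply (𝕜 := ℝ) (m := (4, 4)) le_rfl hn f x⟩
  have _i1 := StubFluxTransfer.finiteDimensional_continuousMultilinearMap 1
  have _i2 := StubFluxTransfer.finiteDimensional_continuousMultilinearMap 2
  have _i3 := StubFluxTransfer.finiteDimensional_continuousMultilinearMap 3
  obtain ⟨hv1, hvJ, -⟩ := StubFluxTransfer.jet_bounds (f.smooth ⊤) hS
  obtain ⟨hS0, -⟩ := StubFluxTransfer.nonneg_of_decay hvJ
  -- the quadratic bound on `Dm`
  obtain ⟨M, hM0, hM⟩ := norm_fderiv_le_of_cubic (hsm.of_le (by exact_mod_cast le_top)) hhom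
  -- continuity of the integrand
  have hbc : ∀ n : ℕ, Continuous fun x => iteratedFDeriv ℝ n b x := fun n =>
    hbs.continuous_iteratedFDeriv (by exact_mod_cast le_top)
  have hJb : Continuous fun x => (b x, iteratedFDeriv ℝ 1 b x, iteratedFDeriv ℝ 2 b x, iteratedFDeriv ℝ 3 b x) :=
    hbs.continuous.prodMk ((hbc 1).prodMk ((hbc 2).prodMk (hbc 3)))
  have hF : Continuous fun x => fderiv ℝ m (f x, iteratedFDeriv ℝ 1 (⇑f) x, iteratedFDeriv ℝ 2 (⇑f) x,
      iteratedFDeriv ℝ 3 (⇑f) x) (b x, iteratedFDeriv ℝ 1 b x, iteratedFDeriv ℝ 2 b x, iteratedFDeriv ℝ 3 b x) :=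
    (((hsm.continuous_fderiv (by simp)).comp hv1.continuous).clm_apply hJb)
  -- the dominating function
  have hsq : ∀ n : ℕ, Integrable (fun x => ‖iteratedFDeriv ℝ n b x‖ ^ 2) := fun n =>
    (hbL2 n).integrable_norm_pow two_ne_zero
  set K : ℝ := M * S ^ 2 with hK
  have hdom : Integrable fun x => K ^ 2 / 2 * ((1 + ‖x‖) ^ 4)⁻¹ +
      2 * (‖iteratedFDeriv ℝ 0 b x‖ ^ 2 + ‖iteratedFDeriv ℝ 1 b x‖ ^ 2 + ‖iteratedFDeriv ℝ 2 b x‖ ^ 2 +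
        ‖iteratedFDeriv ℝ 3 b x‖ ^ 2) :=
    (StubFluxTransfer.integrable_inv_one_add_norm_pow.const_mul _).add
      (((((hsq 0).add (hsq 1)).add (hsq 2)).add (hsq 3)).const_mul 2)
  refine hdom.mono' hF.aestronglyMeasurable (Filter.Eventually.of_forall fun x => ?_)
  -- pointwise bound `|Dm(Jv)[Jb]| ≤ K ρ ‖Jb‖ ≤ (K² ρ + ‖Jb‖²)/2`, `ρ = (1+|x|)⁻⁴ ≤ 1`
  set ρ : ℝ := ((1 + ‖x‖) ^ 4)⁻¹ with hρ
  have hρ0 : 0 ≤ ρ := by positivity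
  have hρ1 : ρ ≤ 1 := inv_le_one_of_one_le₀ (one_le_pow₀ (le_add_of_nonneg_right (norm_nonneg x)))
  set Jv := (f x, iteratedFDeriv ℝ 1 (⇑f) x, iteratedFDeriv ℝ 2 (⇑f) x, iteratedFDeriv ℝ 3 (⇑f) x) with hJv
  set Jb := (b x, iteratedFDeriv ℝ 1 b x, iteratedFDeriv ℝ 2 b x, iteratedFDeriv ℝ 3 b x) with hJbx
  have hK0 : 0 ≤ K := by rw [hK]; positivity
  have h1 : ‖fderiv ℝ m Jv Jb‖ ≤ K * ρ * ‖Jb‖ := by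
    calc ‖fderiv ℝ m Jv Jb‖ ≤ ‖fderiv ℝ m Jv‖ * ‖Jb‖ := ContinuousLinearMap.le_opNorm _ _
      _ ≤ M * ‖Jv‖ ^ 2 * ‖Jb‖ := mul_le_mul_of_nonneg_right (hM Jv) (norm_nonneg _)
      _ ≤ M * (S * ρ) ^ 2 * ‖Jb‖ := by
          refine mul_le_mul_of_nonneg_right (mul_le_mul_of_nonneg_left ?_ hM0) (norm_nonneg _)
          exact pow_le_pow_left₀ (norm_nonneg _) (hvJ x) 2
      _ = K * ρ * ‖Jb‖ * ρ := by rw [hK]; ring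
      _ ≤ K * ρ * ‖Jb‖ * 1 := mul_le_mul_of_nonneg_left hρ1 (by positivity)
      _ = K * ρ * ‖Jb‖ := mul_one _
  have h2 : K * ρ * ‖Jb‖ ≤ K ^ 2 / 2 * ρ + ‖Jb‖ ^ 2 / 2 := by
    have hρ2 : ρ ^ 2 ≤ ρ := by nlinarith
    nlinarith [sq_nonneg (K * ρ - ‖Jb‖), sq_nonneg K]
  -- `‖Jb‖ ≤` the sum of the norms of its four components, and `(Σ)² ≤ 4 Σ (·)²`
  have h3 : ‖Jb‖ ≤ ‖iteratedFDeriv ℝ 0 b x‖ + ‖iteratedFDeriv ℝ 1 b x‖ +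
      ‖iteratedFDeriv ℝ 2 b x‖ + ‖iteratedFDeriv ℝ 3 b x‖ := by
    have e0 : ‖b x‖ = ‖iteratedFDeriv ℝ 0 b x‖ := norm_iteratedFDeriv_zero.symm
    have ha := norm_nonneg (iteratedFDeriv ℝ 0 b x)
    have hb1 := norm_nonneg (iteratedFDeriv ℝ 1 b x)
    have hb2 := norm_nonneg (iteratedFDeriv ℝ 2 b x)
    have hb3 := norm_nonneg (iteratedFDeriv ℝ 3 b x)
    simp only [hJbx, Prod.norm_mk, e0, max_le_iff]
    refine ⟨by linarith, by linarith, by linarith, by linarith⟩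
  have h4 : ‖Jb‖ ^ 2 ≤ 4 * (‖iteratedFDeriv ℝ 0 b x‖ ^ 2 + ‖iteratedFDeriv ℝ 1 b x‖ ^ 2 +
      ‖iteratedFDeriv ℝ 2 b x‖ ^ 2 + ‖iteratedFDeriv ℝ 3 b x‖ ^ 2) := by
    have h3' := pow_le_pow_left₀ (norm_nonneg _) h3 2
    nlinarith [sq_nonneg (‖iteratedFDeriv ℝ 0 b x‖ - ‖iteratedFDeriv ℝ 1 b x‖),
      sq_nonneg (‖iteratedFDeriv ℝ 0 b x‖ - ‖iteratedFDeriv ℝ 2 b x‖),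
      sq_nonneg (‖iteratedFDeriv ℝ 0 b x‖ - ‖iteratedFDeriv ℝ 3 b x‖),
      sq_nonneg (‖iteratedFDeriv ℝ 1 b x‖ - ‖iteratedFDeriv ℝ 2 b x‖),
      sq_nonneg (‖iteratedFDeriv ℝ 1 b x‖ - ‖iteratedFDeriv ℝ 3 b x‖),
      sq_nonneg (‖iteratedFDeriv ℝ 2 b x‖ - ‖iteratedFDeriv ℝ 3 b x‖)]
  linarith [h1, h2, h4]


/-! ### The hyperoctahedral sum of a weight-one density -/

/-- A continuous `1`-multilinear map is linear in its single slot: `A(c e) = c A(e)`. -/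
theorem cmm_one_smul (A : EuclideanSpace ℝ (Fin 3) [×1]→L[ℝ] EuclideanSpace ℝ (Fin 3)) (c : ℝ)
    (e : EuclideanSpace ℝ (Fin 3)) : A (fun _ => c • e) = c • A (fun _ => e) := by
  have h := A.map_smul_univ (fun _ : Fin 1 => c) (fun _ => e)
  simpa using h

/-- Reindexing a four-fold sum over `Fin 3` by a permutation in every index. -/
theorem sum4_reindex (π : Equiv.Perm (Fin 3)) (F : Fin 3 → Fin 3 → Fin 3 → Fin 3 → ℝ) :
    ∑ i, ∑ j, ∑ p, ∑ q, F i j p q = ∑ i, ∑ j, ∑ p, ∑ q, F (π i) (π j) (π p) (π q) := by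
  calc ∑ i, ∑ j, ∑ p, ∑ q, F i j p q = ∑ i, ∑ j, ∑ p, ∑ q, F (π i) j p q :=
        (Equiv.sum_comp π (fun i => ∑ j, ∑ p, ∑ q, F i j p q)).symm
    _ = ∑ i, ∑ j, ∑ p, ∑ q, F (π i) (π j) p q :=
        Finset.sum_congr rfl fun i _ => (Equiv.sum_comp π (fun j => ∑ p, ∑ q, F (π i) j p q)).symm
    _ = ∑ i, ∑ j, ∑ p, ∑ q, F (π i) (π j) (π p) q :=
        Finset.sum_congr rfl fun i _ => Finset.sum_congr rfl fun j _ =>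
          (Equiv.sum_comp π (fun p => ∑ q, F (π i) (π j) p q)).symm
    _ = ∑ i, ∑ j, ∑ p, ∑ q, F (π i) (π j) (π p) (π q) :=
        Finset.sum_congr rfl fun i _ => Finset.sum_congr rfl fun j _ => Finset.sum_congr rfl fun p _ =>
          (Equiv.sum_comp π (fun q => F (π i) (π j) (π p) q)).symm

/-- **A weight-one density transformed by a signed permutation, in coordinates.** If
`m(z) = Σ τ_ijpq z₀ᵢ z₀ⱼ (z₁ e_p)_q` and `R` is the signed permutation `(σ, π)`, then `m(ρ_R z)` — `ρ_R` the jet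
action `(R z₀, R ∘ z₁ ∘ R⁻¹, …)` written out as in `morawetzQ_rotate` — equals
`Σ_ijpq τ(πi)(πj)(πp)(πq) σ(πi)σ(πj)σ(πp)σ(πq) z₀ᵢ z₀ⱼ (z₁ e_p)_q` (the summand of the hyperoctahedral averaging
identity). -/
theorem density_signedPerm
    {m : EuclideanSpace ℝ (Fin 3) × (EuclideanSpace ℝ (Fin 3) [×1]→L[ℝ] EuclideanSpace ℝ (Fin 3)) × (EuclideanSpace ℝ (Fin 3) [×2]→L[ℝ] EuclideanSpace ℝ (Fin 3)) × (EuclideanSpace ℝ (Fin 3) [×3]→L[ℝ] EuclideanSpace ℝ (Fin 3)) → ℝ}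
    {τ : Fin 3 → Fin 3 → Fin 3 → Fin 3 → ℝ}
    (hτ : ∀ (z₀ : EuclideanSpace ℝ (Fin 3))
          (z₁ : EuclideanSpace ℝ (Fin 3) [×1]→L[ℝ] EuclideanSpace ℝ (Fin 3))
          (z₂ : EuclideanSpace ℝ (Fin 3) [×2]→L[ℝ] EuclideanSpace ℝ (Fin 3))
          (z₃ : EuclideanSpace ℝ (Fin 3) [×3]→L[ℝ] EuclideanSpace ℝ (Fin 3)),
        m (z₀, z₁, z₂, z₃) = ∑ i, ∑ j, ∑ p, ∑ q,
          τ i j p q * z₀ i * z₀ j * z₁ (fun _ => EuclideanSpace.single p (1 : ℝ)) q)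
    {s : Fin 3 → Bool} {π : Equiv.Perm (Fin 3)}
    {R : EuclideanSpace ℝ (Fin 3) ≃ₗᵢ[ℝ] EuclideanSpace ℝ (Fin 3)}
    (hR : ∀ (x : EuclideanSpace ℝ (Fin 3)) (i : Fin 3), R x i = (if s i then (1 : ℝ) else -1) * x (π.symm i))
    (z : EuclideanSpace ℝ (Fin 3) × (EuclideanSpace ℝ (Fin 3) [×1]→L[ℝ] EuclideanSpace ℝ (Fin 3)) × (EuclideanSpace ℝ (Fin 3) [×2]→L[ℝ] EuclideanSpace ℝ (Fin 3)) × (EuclideanSpace ℝ (Fin 3) [×3]→L[ℝ] EuclideanSpace ℝ (Fin 3))) :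
    m (R z.1,
        (R.toContinuousLinearEquiv : EuclideanSpace ℝ (Fin 3) →L[ℝ] EuclideanSpace ℝ (Fin 3)).compContinuousMultilinearMap
          (z.2.1.compContinuousLinearMap fun _ =>
            (R.symm.toContinuousLinearEquiv : EuclideanSpace ℝ (Fin 3) →L[ℝ] EuclideanSpace ℝ (Fin 3))),
        (R.toContinuousLinearEquiv : EuclideanSpace ℝ (Fin 3) →L[ℝ] EuclideanSpace ℝ (Fin 3)).compContinuousMultilinearMap
          (z.2.2.1.compContinuousLinearMap fun _ =>
            (R.symm.toContinuousLinearEquiv : EuclideanSpace ℝ (Fin 3) →L[ℝ] EuclideanSpace ℝ (Fin 3))),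
        (R.toContinuousLinearEquiv : EuclideanSpace ℝ (Fin 3) →L[ℝ] EuclideanSpace ℝ (Fin 3)).compContinuousMultilinearMap
          (z.2.2.2.compContinuousLinearMap fun _ =>
            (R.symm.toContinuousLinearEquiv : EuclideanSpace ℝ (Fin 3) →L[ℝ] EuclideanSpace ℝ (Fin 3)))) =
      ∑ i, ∑ j, ∑ p, ∑ q,
        τ (π i) (π j) (π p) (π q) *
          ((if s (π i) then (1 : ℝ) else -1) * (if s (π j) then (1 : ℝ) else -1) *
            (if s (π p) then (1 : ℝ) else -1) * (if s (π q) then (1 : ℝ) else -1)) *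
          (z.1 i * z.1 j * z.2.1 (fun _ => EuclideanSpace.single p (1 : ℝ)) q) := by
  rw [hτ]
  have hev : ∀ p q : Fin 3,
      ((R.toContinuousLinearEquiv : EuclideanSpace ℝ (Fin 3) →L[ℝ] EuclideanSpace ℝ (Fin 3)).compContinuousMultilinearMap
          (z.2.1.compContinuousLinearMap fun _ =>
            (R.symm.toContinuousLinearEquiv : EuclideanSpace ℝ (Fin 3) →L[ℝ] EuclideanSpace ℝ (Fin 3))))
        (fun _ => EuclideanSpace.single p (1 : ℝ)) q =
      (if s q then (1 : ℝ) else -1) * ((if s p then (1 : ℝ) else -1) *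
        z.2.1 (fun _ => EuclideanSpace.single (π.symm p) (1 : ℝ)) (π.symm q)) := by
    intro p q
    simp only [ContinuousLinearMap.compContinuousMultilinearMap_coe, Function.comp_apply,
      ContinuousMultilinearMap.compContinuousLinearMap_apply, ContinuousLinearEquiv.coe_coe,
      LinearIsometryEquiv.coe_toContinuousLinearEquiv]
    rw [signedPerm_symm_single hR p, cmm_one_smul, hR, PiLp.smul_apply, smul_eq_mul]
  simp only [hR, hev]
  rw [sum4_reindex π]
  refine Finset.sum_congr rfl fun i _ => Finset.sum_congr rfl fun j _ => Finset.sum_congr rfl fun p _ =>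
    Finset.sum_congr rfl fun q _ => ?_
  simp only [Equiv.symm_apply_apply]
  ring


end Summit.NavierStokesRegularity.NavierStokesRegularity.Theorems

end
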